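import Mathlib
import Summits.Ventures.LatticeQCDFlow.TrivializingMaps.SliceCovGramBound
import Summits.Ventures.LatticeQCDFlow.TrivializingMaps.WitnessStapleWord
import Summits.Ventures.LatticeQCDFlow.TrivializingMaps.WitnessColumnPlaquette
import HarnessLib

/-!
# THEOREM P — the nearest-neighbour slice covariance of the plaquette is strictly positive

HONEST FRAMING: exact (Metropolis-corrected) sampling algorithms for lattice gauge theory; figures of
merit are autocorrelation/cost numbers at stated couplings and volumes; no continuum-physics claim.

(O3) of THEORY-1, residual form (§38): `c₁ := K(1) = Cov_β(Re tr ρ(U_p), Re tr ρ(U_{p+e₀})) > 0`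
for a spatial plaquette `p` and its time-neighbour. THEOREM W′ (`WitnessColumnRP`, `…LinkRP`) gave
`K(1) ≥ 0` by link reflection positivity and THEOREM V (`WitnessVarianceFloor`) `v = K(0) > 0`; the
one number left open was the SIGN `K(1) > 0`. This file proves it for every compact `G`, continuous
`ρ`, `β > 0`, even `L`, `d ≥ 2`, with an explicit constant, and hypothesis-free for lattice `SU(n)`.

THE MECHANISM (strict reflection positivity by a four-staple Gram word). THEOREM P′
(`SliceCovGramBound`): `K(1) ≥ e^{-βN#plaq} Σ_{n ∈ s} (1/n!) Σ_{w ∈ Iⁿ} |m_w|²`, `m_w = ∫ g ∏ₜ a_{wₜ}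
dHaar^E` the word moments of the Osterwalder–Seiler letters. Take `s = {0, 4}`: the empty word is
`u = ∫ g = ∫ (X⁽¹⁾ - c) e^{βA} dHaar^E` (`c = ⟨X⟩_β`); the four lower crossing staples around the
time-neighbour plaquette `p₁ = p + e₀` multiply to a conjugate of its holonomy (`WitnessStapleWord`),
so `v := Σ_ω m_{stapleWord ω} = (β/2)² ∫ g · tr ρ(U_{p₁})` and `Re v - (β/2)² c Re u
= (β/2)² ∫ (X⁽¹⁾-c)² e^{βA} ≥ (β/2)² e^{-βN#plaq} Q`, `Q := ∫ (X⁽¹⁾ - c)² dHaar^E`. Since `K(1)`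
dominates `|u|²` and every `|m_{stapleWord ω}|²`, Cauchy–Schwarz closes:
  **`K(1) ≥ e^{-3βN#plaq} · β⁴ / ((16 + β⁴N²)(1 + 24 N⁸)) · Q²`** (`plaqRe_sliceCov_one_lower`).
For `G = SU(n)`, `n ≥ 2` (defining representation) `Q ≥ m₂(n) = ∫_{SU(n)} (Re tr)² > 0`
(`haarSqReTrace_le_Q`, tree `PlaquetteHaarMoments`), hence
  **`0 < K(1)`, every `β > 0`, every even `L`, every `d ≥ 2`** (`plaqRe_sliceCov_one_pos`) — the
hypothesis `hc : 0 < c₁` of THEOREM W′'s envelope and footprint corollary, discharged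
(dock: `WitnessNearestNeighbourDock`).

WHAT THIS DOES AND DOES NOT SAY. The constant is explicit but exponentially small in the VOLUME
(`e^{-3βN#plaq}`, from `Z ≤ 1` and `e^{βA} ≥ e^{-βN#plaq}` crudely); it proves the SIGN and
`m₁ := -log(K(1)/K(0)) < ∞`, not a useful number. A volume-uniform floor (`c₁ ≥ I β⁴ + O(β⁵)`
uniformly in `L`; a transfer-matrix gap bound) is NOT CLAIMED; neither are `β < 0`, odd `t ≥ 3`, `d = 1`.

References: K. Osterwalder, E. Seiler, Ann. Phys. 110 (1978) 440; E. Seiler, LNP 159 (1982);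
M. Lüscher, Commun. Math. Phys. 54 (1977) 283; M. Creutz, *Quarks, gluons and lattices* (1983) ch. 9.
-/

noncomputable section

namespace Summit.Ventures.LatticeQCDFlow.TrivializingMaps

open MeasureTheory Finset
open scoped ComplexOrder ComplexConjugate

namespace WitnessColumn

open Literature.MathematicalPhysics.QuantumFieldTheory
open Literature.RepresentationTheory.CompactGroups

section General

variable {d L : ℕ} [NeZero d] [NeZero L] {G : Type*} [Group G] [TopologicalSpace G]
  [IsTopologicalGroup G] [CompactSpace G] [MeasurableSpace G] [BorelSpace G] {N : ℕ}
  (ρ : G →* Matrix (Fin N) (Fin N) ℂ)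

/-! ## §1. THEOREM P (general compact `G`) -/

omit [NeZero d] in
/-- Bounded measurable complex functions on the configuration space are integrable for Haar^E. -/
private theorem integrable_haar_of_norm_le {f : GaugeConfig d L G → ℂ} (hf : Measurable f) (K : ℝ)
    (hK : ∀ U, ‖f U‖ ≤ K) : Integrable f (Measure.pi fun _ : Edge d L => haarProbability G) :=
  Integrable.of_bound hf.aestronglyMeasurable K (ae_of_all _ hK)

set_option maxHeartbeats 800000 in
/-- **THEOREM P (general compact `G`, explicit constant).** For `β > 0`, `L` even, `d ≥ 2`, a
continuous representation `ρ` and a spatial plaquette `p = (x; i, j)` of the slice `x₀ = 0`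
(`0 < i < j`), with `X = Re tr ρ(U_p)`, `c = ⟨X⟩_β`, `X⁽¹⁾ = Re tr ρ(U_{p+e₀})` and
`Q = ∫ (X⁽¹⁾ - c)² dHaar^E`:
`e^{-3βN#plaq} · β⁴ / ((16 + β⁴N²)(1 + 24N⁸)) · Q² ≤ K(1) = sliceCov ρ β X 1`. -/
theorem plaqRe_sliceCov_one_lower (hL : Even L) (hρ : Continuous ρ) {β : ℝ} (hβ : 0 < β)
    (p : Plaquette d L) (h0 : p.1 0 = 0) (hi : 0 < p.2.1.1) :
    Real.exp (-(3 * β * (N * Fintype.card (Plaquette d L))))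
        * (β ^ 4 / ((16 + β ^ 4 * (N : ℝ) ^ 2) * (1 + 24 * (N : ℝ) ^ 8)))
        * (∫ U, (timeTranslate (1 : ZMod L) (fun V : GaugeConfig d L G => WilsonRP.plaqRe ρ V p) U
              - ∫ V, WilsonRP.plaqRe ρ V p ∂(wilsonMeasure ρ β)) ^ 2
            ∂(Measure.pi fun _ : Edge d L => haarProbability G)) ^ 2
      ≤ sliceCov ρ β (fun V : GaugeConfig d L G => WilsonRP.plaqRe ρ V p) 1 := by
  haveI : Fact (1 < L) := ⟨by obtain ⟨r, hr⟩ := hL; have := NeZero.ne L; omega⟩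
  haveI := isProbabilityMeasure_wilsonMeasure (d := d) (L := L) ρ hρ β
  obtain ⟨x, ⟨⟨i, j⟩, hij⟩⟩ := p
  simp only at h0 hi hij
  have hj : (0 : Fin d) < j := hi.trans hij
  set μ : Measure (GaugeConfig d L G) := Measure.pi fun _ : Edge d L => haarProbability G with hμ
  set p : Plaquette d L := (x, ⟨(i, j), hij⟩) with hp
  set X : GaugeConfig d L G → ℝ := fun V => WilsonRP.plaqRe ρ V p with hX_def
  set c : ℝ := ∫ V, X V ∂(wilsonMeasure ρ β) with hc_def
  set X1 : GaugeConfig d L G → ℝ := timeTranslate (1 : ZMod L) X with hX1_def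
  set B : ℝ := (N : ℝ) * Fintype.card (Plaquette d L) with hB_def
  set wA : GaugeConfig d L G → ℝ := fun V => Real.exp (β * WilsonRP.posAction ρ V) with hwA_def
  set Q : ℝ := ∫ U, (X1 U - c) ^ 2 ∂μ with hQ_def
  have hXm : Measurable X := WilsonRP.measurable_plaqRe ρ hρ p
  have hXb : ∀ U, |X U| ≤ N := fun U => WilsonRP.abs_plaqRe_le ρ hρ U p
  have hXdep : DependsOn X (sliceEdges d L 0) := dependsOn_plaqRe_slice ρ (p := p) h0 hi.ne' hj.ne'
  have hX1m : Measurable X1 := measurable_timeTranslate hXm 1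
  have hX1b : ∀ U, |X1 U| ≤ N := fun U => hXb _
  have hcN : |c| ≤ N := by
    have h := norm_integral_le_of_norm_le_const (μ := wilsonMeasure ρ β) (f := X) (C := (N : ℝ))
      (ae_of_all _ fun U => by rw [Real.norm_eq_abs]; exact hXb U)
    rwa [probReal_univ, mul_one, Real.norm_eq_abs] at h
  have hwApos : ∀ V, 0 < wA V := fun V => Real.exp_pos _
  have hwAlow : ∀ V, Real.exp (-(β * B)) ≤ wA V := fun V => by
    rw [hB_def, hwA_def]
    refine Real.exp_le_exp.2 ?_
    have h := WilsonRP.abs_posAction_le ρ hρ V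
    rw [abs_le] at h
    nlinarith [h.1, hβ.le]
  have hwAm : Measurable wA := ((WilsonRP.measurable_posAction ρ hρ).const_mul β).exp
  have hwAb : ∀ V, |wA V| ≤ Real.exp (β * B) := fun V => by
    rw [abs_of_pos (hwApos V)]
    exact Real.exp_le_exp.2 (mul_le_mul_of_nonneg_left
      ((le_abs_self _).trans (WilsonRP.abs_posAction_le ρ hρ V)) hβ.le)
  have hdev : ∀ U, |X1 U - c| ≤ N + |c| := fun U => (abs_sub _ _).trans (add_le_add (hX1b U) le_rfl)
  -- the test observable and `g = (X⁽¹⁾ - c) e^{βA}`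
  have hg : ∀ V, WilsonRP.gObs ρ β (sliceTest ρ β X) V = (((X1 V - c) * wA V : ℝ) : ℂ) := fun V => by
    rw [Complex.ofReal_mul]; rfl
  have hgm : Measurable (WilsonRP.gObs ρ β (sliceTest ρ β X)) :=
    WilsonRP.measurable_gObs ρ hρ β (measurable_sliceTest ρ β hXm)
  have hgb : ∀ V, ‖WilsonRP.gObs ρ β (sliceTest ρ β X) V‖ ≤ abs ((N : ℝ) + |c|) * Real.exp (β * B) :=
    WilsonRP.norm_gObs_le ρ hρ hβ.le (norm_sliceTest_le ρ β hXb)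
  -- the trace observable `τ = tr ρ(U_{p₁})`: real part, measurability, bound
  have hτre : ∀ V, (ρ (plaquetteHolonomy V (x.shift 0) i j)).trace.re = X1 V :=
    fun V => (timeTranslate_one_plaqRe ρ p V).symm
  have hτm : Measurable fun V : GaugeConfig d L G => (ρ (plaquetteHolonomy V (x.shift 0) i j)).trace := by
    have hE : WilsonRP.EntryMeasurable ρ
        (fun V : GaugeConfig d L G => plaquetteHolonomy V (x.shift 0) i j) := by
      unfold plaquetteHolonomy
      exact (((WilsonRP.entryMeasurable_apply hρ _).mul (WilsonRP.entryMeasurable_apply hρ _)).mul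
        (WilsonRP.entryMeasurable_apply_inv hρ _)).mul (WilsonRP.entryMeasurable_apply_inv hρ _)
    have h : Measurable fun V : GaugeConfig d L G =>
        ∑ k, ρ (plaquetteHolonomy V (x.shift 0) i j) k k :=
      Finset.measurable_sum _ fun k _ => hE k k
    simpa only [Matrix.trace, Matrix.diag_apply] using h
  have hτb : ∀ V, ‖(ρ (plaquetteHolonomy V (x.shift 0) i j)).trace‖ ≤ N := fun V => by
    have h := CompactGroup.norm_unitarize_apply_le_one ρ hρ (plaquetteHolonomy V (x.shift 0) i j)
    rw [← CompactGroup.trace_unitarize ρ hρ]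
    calc ‖(CompactGroup.unitarize ρ hρ (plaquetteHolonomy V (x.shift 0) i j)).trace‖
        = ‖∑ k, CompactGroup.unitarize ρ hρ (plaquetteHolonomy V (x.shift 0) i j) k k‖ := by
          simp only [Matrix.trace, Matrix.diag_apply]
      _ ≤ ∑ k, ‖CompactGroup.unitarize ρ hρ (plaquetteHolonomy V (x.shift 0) i j) k k‖ :=
          norm_sum_le _ _
      _ ≤ ∑ _k : Fin N, (1 : ℝ) := Finset.sum_le_sum fun k _ => h k k
      _ = N := by simp
  have hword_int : ∀ {n : ℕ} (w : Fin n → WilsonRP.CoeffIndex d L N), Integrable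
      (fun U => WilsonRP.gObs ρ β (sliceTest ρ β X) U * ∏ t, WilsonRP.coeff ρ hρ β (w t) U) μ := by
    intro n w
    refine integrable_haar_of_norm_le (hgm.mul (Finset.measurable_prod _ fun t _ =>
      WilsonRP.measurable_coeff ρ hρ β (w t)))
      (abs ((N : ℝ) + |c|) * Real.exp (β * B) * Real.sqrt (β / 2) ^ n) fun U => ?_
    rw [norm_mul]
    refine mul_le_mul (hgb U) ?_ (norm_nonneg _) (by positivity)
    calc ‖∏ t, WilsonRP.coeff ρ hρ β (w t) U‖ = ∏ t, ‖WilsonRP.coeff ρ hρ β (w t) U‖ := norm_prod _ _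
      _ ≤ ∏ _t : Fin n, Real.sqrt (β / 2) := Finset.prod_le_prod (fun _ _ => norm_nonneg _)
          fun t _ => WilsonRP.norm_coeff_le ρ hρ β (w t) U
      _ = Real.sqrt (β / 2) ^ n := by rw [Finset.prod_const, Finset.card_univ, Fintype.card_fin]
  -- `u` = the empty word moment, `v` = the sum of the four-staple word moments
  set u : ℂ := wordMoment ρ hρ β X (Fin.elim0 : Fin 0 → WilsonRP.CoeffIndex d L N) with hu_def
  set v : ℂ := ∑ ω : Fin N × Fin N × Fin N × Fin N,
    wordMoment ρ hρ β X (stapleWord x i j hi hj ω) with hv_def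
  have hu_int : u = ∫ U, WilsonRP.gObs ρ β (sliceTest ρ β X) U ∂μ := by
    rw [hu_def, hμ, wordMoment]
    simp
  have hv_int : v = ∫ U, WilsonRP.gObs ρ β (sliceTest ρ β X) U
      * ((((β / 2) ^ 2 : ℝ) : ℂ) * (ρ (plaquetteHolonomy U (x.shift 0) i j)).trace) ∂μ := by
    have hw : ∀ ω : Fin N × Fin N × Fin N × Fin N, wordMoment ρ hρ β X (stapleWord x i j hi hj ω)
        = ∫ U, WilsonRP.gObs ρ β (sliceTest ρ β X) U
            * ∏ t, WilsonRP.coeff ρ hρ β (stapleWord x i j hi hj ω t) U ∂μ := fun ω => rfl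
    rw [hv_def]
    simp_rw [hw]
    rw [← integral_finsetSum _ fun ω _ => hword_int _]
    refine integral_congr_ae (ae_of_all _ fun U => ?_)
    dsimp only
    rw [← Finset.mul_sum, sum_prod_coeff_stapleWord ρ hρ hβ.le x h0 hi hj U]
  -- real parts: `Re u = ∫ (X⁽¹⁾-c) e^{βA}`, `Re v = (β/2)² ∫ (X⁽¹⁾-c) e^{βA} X⁽¹⁾`
  have hint_r1 : Integrable (fun U => (X1 U - c) * wA U) μ :=
    Integrable.of_bound ((hX1m.sub measurable_const).mul hwAm).aestronglyMeasurable
      ((N + |c|) * Real.exp (β * B)) (ae_of_all _ fun U => by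
        rw [Real.norm_eq_abs, abs_mul]
        exact mul_le_mul (hdev U) (hwAb U) (abs_nonneg _) (by positivity))
  have hint_r2 : Integrable (fun U => (X1 U - c) * wA U * X1 U) μ :=
    Integrable.of_bound (((hX1m.sub measurable_const).mul hwAm).mul hX1m).aestronglyMeasurable
      ((N + |c|) * Real.exp (β * B) * N) (ae_of_all _ fun U => by
        rw [Real.norm_eq_abs, abs_mul, abs_mul]
        exact mul_le_mul (mul_le_mul (hdev U) (hwAb U) (abs_nonneg _) (by positivity)) (hX1b U)
          (abs_nonneg _) (by positivity))
  have hu_re : u.re = ∫ U, (X1 U - c) * wA U ∂μ := by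
    rw [hu_int]
    simp_rw [hg]
    rw [integral_complex_ofReal, Complex.ofReal_re]
  have hv_re : v.re = (β / 2) ^ 2 * ∫ U, (X1 U - c) * wA U * X1 U ∂μ := by
    have hpt : ∀ U, WilsonRP.gObs ρ β (sliceTest ρ β X) U
        * ((((β / 2) ^ 2 : ℝ) : ℂ) * (ρ (plaquetteHolonomy U (x.shift 0) i j)).trace)
        = ((((β / 2) ^ 2 * ((X1 U - c) * wA U) : ℝ) : ℂ))
          * (ρ (plaquetteHolonomy U (x.shift 0) i j)).trace := fun U => by
      rw [hg]; push_cast; ring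
    have hint : Integrable (fun U => ((((β / 2) ^ 2 * ((X1 U - c) * wA U) : ℝ) : ℂ))
        * (ρ (plaquetteHolonomy U (x.shift 0) i j)).trace) μ := by
      refine integrable_haar_of_norm_le
        ((Complex.measurable_ofReal.comp (((hX1m.sub measurable_const).mul hwAm).const_mul _)).mul hτm)
        ((β / 2) ^ 2 * ((N + |c|) * Real.exp (β * B)) * N) fun U => ?_
      rw [norm_mul, Complex.norm_real, Real.norm_eq_abs, abs_mul,
        abs_of_nonneg (by positivity : (0 : ℝ) ≤ (β / 2) ^ 2), abs_mul]
      refine mul_le_mul (mul_le_mul_of_nonneg_left ?_ (by positivity)) (hτb U) (norm_nonneg _)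
        (by positivity)
      exact mul_le_mul (hdev U) (hwAb U) (abs_nonneg _) (by positivity)
    rw [hv_int]
    simp_rw [hpt]
    have hcomm := Complex.reCLM.integral_comp_comm hint
    simp only [Complex.reCLM_apply] at hcomm
    rw [← hcomm]
    simp_rw [Complex.re_ofReal_mul, hτre]
    rw [← integral_const_mul]
    refine integral_congr_ae (ae_of_all _ fun U => ?_)
    ring
  -- `J := Re v - (β/2)² c Re u = (β/2)² ∫ (X⁽¹⁾ - c)² e^{βA} ≥ (β/2)² e^{-βB} Q ≥ 0`
  have hQ_int : Integrable (fun U => (X1 U - c) ^ 2) μ :=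
    Integrable.of_bound ((hX1m.sub measurable_const).pow_const 2).aestronglyMeasurable
      ((N + |c|) ^ 2) (ae_of_all _ fun U => by
        rw [Real.norm_eq_abs, abs_pow]
        exact pow_le_pow_left₀ (abs_nonneg _) (hdev U) 2)
  have hQwA_int : Integrable (fun U => (X1 U - c) ^ 2 * wA U) μ :=
    Integrable.of_bound (((hX1m.sub measurable_const).pow_const 2).mul hwAm).aestronglyMeasurable
      ((N + |c|) ^ 2 * Real.exp (β * B)) (ae_of_all _ fun U => by
        rw [Real.norm_eq_abs, abs_mul, abs_pow]
        exact mul_le_mul (pow_le_pow_left₀ (abs_nonneg _) (hdev U) 2) (hwAb U) (abs_nonneg _)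
          (by positivity))
  have hQnn : 0 ≤ Q := integral_nonneg fun U => sq_nonneg _
  have hJ_eq : v.re - (β / 2) ^ 2 * c * u.re = (β / 2) ^ 2 * ∫ U, (X1 U - c) ^ 2 * wA U ∂μ := by
    have e : ∫ U, (X1 U - c) ^ 2 * wA U ∂μ
        = ∫ U, ((X1 U - c) * wA U * X1 U - c * ((X1 U - c) * wA U)) ∂μ :=
      integral_congr_ae (ae_of_all _ fun U => by simp only; ring)
    rw [e, integral_sub hint_r2 (hint_r1.const_mul c), integral_const_mul, hv_re, hu_re]
    ring
  have hJ_low : (β / 2) ^ 2 * (Real.exp (-(β * B)) * Q) ≤ v.re - (β / 2) ^ 2 * c * u.re := by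
    rw [hJ_eq]
    refine mul_le_mul_of_nonneg_left ?_ (by positivity)
    rw [hQ_def, ← integral_const_mul]
    refine integral_mono (hQ_int.const_mul _) hQwA_int fun U => ?_
    simp only
    rw [mul_comm]
    exact mul_le_mul_of_nonneg_left (hwAlow U) (sq_nonneg _)
  have hJnn : 0 ≤ v.re - (β / 2) ^ 2 * c * u.re :=
    le_trans (mul_nonneg (by positivity) (mul_nonneg (Real.exp_pos _).le hQnn)) hJ_low
  -- THEOREM P′ with `s = {0, 4}`: `e^{-βB} (|u|² + (1/24) Σ_{w ∈ I⁴} |m_w|²) ≤ K(1)`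
  set R : ℝ := ∑ w : Fin 4 → WilsonRP.CoeffIndex d L N, ‖wordMoment ρ hρ β X w‖ ^ 2 with hR_def
  have hRnn : 0 ≤ R := Finset.sum_nonneg fun w _ => sq_nonneg _
  have hP : Real.exp (-(β * B)) * (‖u‖ ^ 2 + (24 : ℝ)⁻¹ * R) ≤ sliceCov ρ β X 1 := by
    have h := sum_wordMoment_le_sliceCov_one ρ hL hρ hβ.le hXm hXb hXdep ({0, 4} : Finset ℕ)
    have h0' : ∑ w : Fin 0 → WilsonRP.CoeffIndex d L N, ‖wordMoment ρ hρ β X w‖ ^ 2 = ‖u‖ ^ 2 := by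
      rw [hu_def, Fintype.sum_unique,
        Subsingleton.elim (default : Fin 0 → WilsonRP.CoeffIndex d L N) Fin.elim0]
    have h4 : ((Nat.factorial 4 : ℕ) : ℝ)⁻¹
        * ∑ w : Fin 4 → WilsonRP.CoeffIndex d L N, ‖wordMoment ρ hρ β X w‖ ^ 2 = (24 : ℝ)⁻¹ * R := by
      rw [hR_def, show Nat.factorial 4 = 24 by rfl]
      norm_num
    have hexpB : Real.exp (-β * ((N : ℝ) * Fintype.card (Plaquette d L))) = Real.exp (-(β * B)) := by
      rw [hB_def, neg_mul]
    rw [Finset.sum_pair (by norm_num), h0', h4, Nat.factorial_zero, Nat.cast_one, inv_one, one_mul,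
      hexpB] at h
    exact h
  -- every four-staple word moment is dominated: `|m_{w(ω)}|² ≤ R`, hence `|v|² ≤ N⁸ R`
  have hmR : ∀ ω : Fin N × Fin N × Fin N × Fin N,
      ‖wordMoment ρ hρ β X (stapleWord x i j hi hj ω)‖ ^ 2 ≤ R := fun ω =>
    Finset.single_le_sum (f := fun w : Fin 4 → WilsonRP.CoeffIndex d L N => ‖wordMoment ρ hρ β X w‖ ^ 2)
      (fun w _ => sq_nonneg _) (Finset.mem_univ _)
  have hvR : ‖v‖ ^ 2 ≤ (N : ℝ) ^ 8 * R := by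
    have h1 : ‖v‖ ≤ (N : ℝ) ^ 4 * Real.sqrt R := by
      calc ‖v‖ ≤ ∑ ω : Fin N × Fin N × Fin N × Fin N, ‖wordMoment ρ hρ β X (stapleWord x i j hi hj ω)‖ :=
            norm_sum_le _ _
        _ ≤ ∑ _ω : Fin N × Fin N × Fin N × Fin N, Real.sqrt R := Finset.sum_le_sum fun ω _ => by
            rw [← Real.sqrt_sq (norm_nonneg _)]
            exact Real.sqrt_le_sqrt (hmR ω)
        _ = (N : ℝ) ^ 4 * Real.sqrt R := by
            rw [Finset.sum_const, Finset.card_univ, nsmul_eq_mul]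
            simp only [Fintype.card_prod, Fintype.card_fin]
            push_cast
            ring
    calc ‖v‖ ^ 2 ≤ ((N : ℝ) ^ 4 * Real.sqrt R) ^ 2 := pow_le_pow_left₀ (norm_nonneg _) h1 2
      _ = (N : ℝ) ^ 8 * R := by rw [mul_pow, Real.sq_sqrt hRnn]; ring
  -- Cauchy–Schwarz and assembly
  have hJ_up : v.re - (β / 2) ^ 2 * c * u.re ≤ ‖v‖ + (β / 2) ^ 2 * |c| * ‖u‖ := by
    have h1 : v.re ≤ ‖v‖ := Complex.re_le_norm v
    have h2 : |(β / 2) ^ 2 * c * u.re| ≤ (β / 2) ^ 2 * |c| * ‖u‖ := by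
      rw [abs_mul, abs_mul, abs_of_nonneg (by positivity : (0 : ℝ) ≤ (β / 2) ^ 2)]
      exact mul_le_mul_of_nonneg_left (Complex.abs_re_le_norm u) (by positivity)
    have h3 := neg_abs_le ((β / 2) ^ 2 * c * u.re)
    linarith
  have hN0 : (0 : ℝ) ≤ (N : ℝ) := Nat.cast_nonneg N
  have hCS : (v.re - (β / 2) ^ 2 * c * u.re) ^ 2
      ≤ (1 + ((β / 2) ^ 2 * |c|) ^ 2) * (‖u‖ ^ 2 + ‖v‖ ^ 2) := by
    have h2 : (v.re - (β / 2) ^ 2 * c * u.re) ^ 2 ≤ (‖v‖ + (β / 2) ^ 2 * |c| * ‖u‖) ^ 2 :=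
      pow_le_pow_left₀ hJnn hJ_up 2
    have hκ : (0 : ℝ) ≤ (β / 2) ^ 2 * |c| := by positivity
    nlinarith [sq_nonneg (‖u‖ - (β / 2) ^ 2 * |c| * ‖v‖), norm_nonneg u, norm_nonneg v]
  have hκN : ((β / 2) ^ 2 * |c|) ^ 2 ≤ (β / 2) ^ 4 * (N : ℝ) ^ 2 := by
    rw [mul_pow, show ((β / 2) ^ 2) ^ 2 = (β / 2) ^ 4 by ring]
    exact mul_le_mul_of_nonneg_left (pow_le_pow_left₀ (abs_nonneg _) hcN 2) (by positivity)
  have huv : ‖u‖ ^ 2 + ‖v‖ ^ 2 ≤ (1 + 24 * (N : ℝ) ^ 8) * (‖u‖ ^ 2 + (24 : ℝ)⁻¹ * R) := by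
    have hx : (1 + 24 * (N : ℝ) ^ 8) * (‖u‖ ^ 2 + (24 : ℝ)⁻¹ * R)
        = ‖u‖ ^ 2 + ‖v‖ ^ 2 + ((24 : ℝ)⁻¹ * R + 24 * (N : ℝ) ^ 8 * ‖u‖ ^ 2
          + ((N : ℝ) ^ 8 * R - ‖v‖ ^ 2)) := by ring
    rw [hx]
    have h1 : (0 : ℝ) ≤ (24 : ℝ)⁻¹ * R := mul_nonneg (by norm_num) hRnn
    have h2 : (0 : ℝ) ≤ 24 * (N : ℝ) ^ 8 * ‖u‖ ^ 2 := by positivity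
    linarith
  have hJQ : (β / 2) ^ 4 * (Real.exp (-(β * B)) ^ 2 * Q ^ 2) ≤ (v.re - (β / 2) ^ 2 * c * u.re) ^ 2 := by
    have h := pow_le_pow_left₀ (mul_nonneg (by positivity) (mul_nonneg (Real.exp_pos _).le hQnn)) hJ_low 2
    calc (β / 2) ^ 4 * (Real.exp (-(β * B)) ^ 2 * Q ^ 2)
        = ((β / 2) ^ 2 * (Real.exp (-(β * B)) * Q)) ^ 2 := by ring
      _ ≤ _ := h
  have hden : 0 < (16 + β ^ 4 * (N : ℝ) ^ 2) * (1 + 24 * (N : ℝ) ^ 8) := by positivity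
  have hchain : β ^ 4 * (Real.exp (-(β * B)) ^ 2 * Q ^ 2)
      ≤ (16 + β ^ 4 * (N : ℝ) ^ 2) * (1 + 24 * (N : ℝ) ^ 8) * (‖u‖ ^ 2 + (24 : ℝ)⁻¹ * R) := by
    have h1 : (β / 2) ^ 4 * (Real.exp (-(β * B)) ^ 2 * Q ^ 2)
        ≤ (1 + (β / 2) ^ 4 * (N : ℝ) ^ 2) * ((1 + 24 * (N : ℝ) ^ 8) * (‖u‖ ^ 2 + (24 : ℝ)⁻¹ * R)) :=
      calc _ ≤ (v.re - (β / 2) ^ 2 * c * u.re) ^ 2 := hJQ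
        _ ≤ (1 + ((β / 2) ^ 2 * |c|) ^ 2) * (‖u‖ ^ 2 + ‖v‖ ^ 2) := hCS
        _ ≤ (1 + (β / 2) ^ 4 * (N : ℝ) ^ 2) * ((1 + 24 * (N : ℝ) ^ 8) * (‖u‖ ^ 2 + (24 : ℝ)⁻¹ * R)) :=
            mul_le_mul (by linarith) huv (by positivity) (by positivity)
    have h2 : (16 : ℝ) * ((β / 2) ^ 4 * (Real.exp (-(β * B)) ^ 2 * Q ^ 2))
        = β ^ 4 * (Real.exp (-(β * B)) ^ 2 * Q ^ 2) := by ring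
    have h3 : (16 : ℝ) * ((1 + (β / 2) ^ 4 * (N : ℝ) ^ 2) * ((1 + 24 * (N : ℝ) ^ 8)
        * (‖u‖ ^ 2 + (24 : ℝ)⁻¹ * R)))
        = (16 + β ^ 4 * (N : ℝ) ^ 2) * (1 + 24 * (N : ℝ) ^ 8) * (‖u‖ ^ 2 + (24 : ℝ)⁻¹ * R) := by ring
    rw [← h2, ← h3]
    exact mul_le_mul_of_nonneg_left h1 (by norm_num)
  have hexp3 : Real.exp (-(3 * β * B)) = Real.exp (-(β * B)) * Real.exp (-(β * B)) ^ 2 := by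
    rw [sq, ← Real.exp_add, ← Real.exp_add]
    congr 1
    ring
  have hfinal : Real.exp (-(3 * β * B)) * (β ^ 4 / ((16 + β ^ 4 * (N : ℝ) ^ 2) * (1 + 24 * (N : ℝ) ^ 8)))
      * Q ^ 2 ≤ Real.exp (-(β * B)) * (‖u‖ ^ 2 + (24 : ℝ)⁻¹ * R) := by
    rw [hexp3]
    have hle : β ^ 4 * (Real.exp (-(β * B)) ^ 2 * Q ^ 2)
        / ((16 + β ^ 4 * (N : ℝ) ^ 2) * (1 + 24 * (N : ℝ) ^ 8)) ≤ ‖u‖ ^ 2 + (24 : ℝ)⁻¹ * R := by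
      rw [div_le_iff₀ hden]
      calc _ ≤ _ := hchain
        _ = _ := by ring
    calc Real.exp (-(β * B)) * Real.exp (-(β * B)) ^ 2
          * (β ^ 4 / ((16 + β ^ 4 * (N : ℝ) ^ 2) * (1 + 24 * (N : ℝ) ^ 8))) * Q ^ 2
        = Real.exp (-(β * B)) * (β ^ 4 * (Real.exp (-(β * B)) ^ 2 * Q ^ 2)
            / ((16 + β ^ 4 * (N : ℝ) ^ 2) * (1 + 24 * (N : ℝ) ^ 8))) := by
          ring
      _ ≤ Real.exp (-(β * B)) * (‖u‖ ^ 2 + (24 : ℝ)⁻¹ * R) :=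
          mul_le_mul_of_nonneg_left hle (Real.exp_pos _).le
  exact hfinal.trans hP

end General

/-! ## §2. Lattice `SU(n)`: `c₁ > 0`, hypothesis-free -/

section SUn

open Matrix

variable {d L n : ℕ} [NeZero d] [NeZero L]

/-- **THEOREM P for lattice `SU(n)` — `c₁ > 0`, hypothesis-free.** Defining representation, `n ≥ 2`,
every `β > 0`, every even `L`, every `d ≥ 2`, every spatial plaquette `p = (x; i, j)` of the slice
`x₀ = 0` (`0 < i < j`):  `0 < K(1) = Cov_β(Re tr U_p, Re tr U_{p+e₀})`.
This is the hypothesis `hc : 0 < c₁` of the footprint corollary of THEOREM W′. -/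
theorem plaqRe_sliceCov_one_pos (hL : Even L) (hn : 2 ≤ n) {β : ℝ} (hβ : 0 < β) (p : Plaquette d L)
    (h0 : p.1 0 = 0) (hi : 0 < p.2.1.1) :
    0 < sliceCov (StrongCoupling.defRep n) β
      (fun V : GaugeConfig d L (specialUnitaryGroup (Fin n) ℂ) => WilsonRP.plaqRe (StrongCoupling.defRep n) V p) 1 := by
  have h2L : 2 ≤ L := by obtain ⟨r, hr⟩ := hL; have := NeZero.ne L; omega
  have hρ : Continuous (StrongCoupling.defRep n) := continuous_subtype_val
  have hlow := plaqRe_sliceCov_one_lower (StrongCoupling.defRep n) hL hρ hβ p h0 hi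
  refine lt_of_lt_of_le ?_ hlow
  have hm2 := haarSqReTrace_pos (n := n) (by omega)
  have hQ := haarSqReTrace_le_Q (d := d) h2L hn (p.1.shift 0) (i := p.2.1.1) (j := p.2.1.2) p.2.2.ne
    (∫ V, WilsonRP.plaqRe (StrongCoupling.defRep n) V p ∂(wilsonMeasure (StrongCoupling.defRep n) β))
  have hQ' : 0 < ∫ U, (timeTranslate (1 : ZMod L)
      (fun V : GaugeConfig d L (specialUnitaryGroup (Fin n) ℂ) => WilsonRP.plaqRe (StrongCoupling.defRep n) V p) U
        - ∫ V, WilsonRP.plaqRe (StrongCoupling.defRep n) V p ∂(wilsonMeasure (StrongCoupling.defRep n) β)) ^ 2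
      ∂(Measure.pi fun _ : Edge d L => haarProbability (specialUnitaryGroup (Fin n) ℂ)) := by
    refine lt_of_lt_of_le (lt_of_lt_of_le hm2 hQ) (le_of_eq ?_)
    refine integral_congr_ae (ae_of_all _ fun U => ?_)
    simp only [timeTranslate_one_plaqRe, StrongCoupling.defRep, Submonoid.subtype_apply]
  positivity

/-- **Numerical face of the constant (honesty).** At `β = 1`, `N = 3` the `β`-rational factor is
`1 / ((16 + 9)(1 + 24·6561)) = 1/3936625`; the volume factor `e^{-3βN#plaq}` makes the bound
astronomically small on any realistic lattice — THEOREM P decides the SIGN of `c₁`, not its size. -/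
example : (1 : ℚ) ^ 4 / ((16 + 1 ^ 4 * 3 ^ 2) * (1 + 24 * 3 ^ 8)) = 1 / 3936625 := by norm_num

end SUn

end WitnessColumn

end Summit.Ventures.LatticeQCDFlow.TrivializingMaps

end
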